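import Summits.QuantumAdvantage.QuantumAdvantage.Theorems.CharDialTransferDialC
import HarnessLib

/-!
# TransferDial D — both pointwise upgrades follow from the transfer lemma

`localToGlobal_of_transfer : TransferTwoOdd → LocalToGlobalTwoOdd` (blocks = the big exchangeability classes),
`formsFromFew_of_transfer : TransferTwoOdd → FormsFromFewTwoOdd` (blocks = the big colour classes),
`closes_of_transfer : TransferTwoOdd → PartnersTwoOdd → StructureLawTwoOdd`, `closes_of_fieldCore`, and the converse
`transfer_partners_of_structureLaw`.

Tree twin, part D of 5, of the decomp-qadv lens-6 g23 node «TransferDial» (`Theses/TransferDial.lean` rev 3, sha256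
1b7fda5a…95ba; declaration bodies copied verbatim, namespace `…Theses.TransferDial` ↦ `…Theorems.TransferDial`).
Residual mode beneath `Theses.CharDial.FrobLiftOdd` (stmt 32599): the target `StructureLawTwoOdd` = lens-6 g20 piece B.
0 sorry; no `instance`, no `notation`, no `native_decide`.
-/

set_option autoImplicit false
set_option linter.dupNamespace false

namespace Summit.QuantumAdvantage.QuantumAdvantage.Theorems.TransferDial

open Classical
open Finset Module
open Summit.QuantumAdvantage.AdviceFreeQNC0
open Literature.Computability.MetaComplexity Literature.Computability.MetaComplexity.Smolensky

/-! ## §3 Kernel: BOTH pointwise upgrades follow from the transfer lemma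

`closes_of_transfer : TransferTwoOdd → PartnersTwoOdd → StructureLawTwoOdd`; the transfer lemma itself follows from the
field core PF in part E (`transferOfFieldCore_holds`). -/

section TransferKernel
variable {p : ℕ} [Fact p.Prime]

/-- Exchangeability is reflexive (tree `SubChar.swapInv_self`). -/
theorem sw_refl {m : ℕ} (f : (Fin m → Bool) → Bool) (i : Fin m) : Sw f i i := SubChar.swapInv_self f i

/-- Exchangeability is symmetric (tree `SubChar.swapInv_symm`). -/
theorem sw_symm {m : ℕ} (f : (Fin m → Bool) → Bool) {i j : Fin m} (h : Sw f i j) : Sw f j i := SubChar.swapInv_symm f h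

/-- `Sw f` is transitive (tree `SubChar.swapInv_conj`: `(i k) = (j i)(j k)(j i)`), hence an equivalence relation. -/
theorem sw_trans {m : ℕ} (f : (Fin m → Bool) → Bool) {i j k : Fin m} (hij : Sw f i j) (hjk : Sw f j k) : Sw f i k :=
  SubChar.swapInv_conj f (SubChar.swapInv_symm f hij) hjk

/-- The exchangeability class of a coordinate. -/
noncomputable def cls {m : ℕ} (f : (Fin m → Bool) → Bool) (i : Fin m) : Finset (Fin m) := univ.filter fun k => Sw f i k

/-- Membership in an exchangeability class. -/
theorem mem_cls {m : ℕ} (f : (Fin m → Bool) → Bool) (i k : Fin m) : k ∈ cls f i ↔ Sw f i k := by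
  simp [cls]

/-- A coordinate lies in its own class. -/
theorem self_mem_cls {m : ℕ} (f : (Fin m → Bool) → Bool) (i : Fin m) : i ∈ cls f i := (mem_cls f i i).2 (sw_refl f i)

/-- Exchangeable coordinates have the same class. -/
theorem cls_eq_of_sw {m : ℕ} (f : (Fin m → Bool) → Bool) {i k : Fin m} (h : Sw f i k) : cls f i = cls f k := by
  ext l
  rw [mem_cls, mem_cls]
  exact ⟨fun hl => sw_trans f (sw_symm f h) hl, fun hl => sw_trans f h hl⟩

/-- The number of exchange partners of `i` other than itself is `#cls − 1`. -/
theorem card_partners_eq {m : ℕ} (f : (Fin m → Bool) → Bool) (i : Fin m) :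
    (univ.filter fun k : Fin m => k ≠ i ∧ Sw f i k).card = (cls f i).card - 1 := by
  have h : (univ.filter fun k : Fin m => k ≠ i ∧ Sw f i k) = (cls f i).erase i := by
    ext k
    simp only [cls, mem_filter, mem_univ, true_and, mem_erase]
  rw [h, card_erase_of_mem (self_mem_cls f i)]

/-- A class is labelled by its least element. -/
noncomputable def lab {m : ℕ} (f : (Fin m → Bool) → Bool) (i : Fin m) : Fin m := (cls f i).min' ⟨i, self_mem_cls f i⟩

/-- The label of a class is a member of it. -/
theorem lab_mem {m : ℕ} (f : (Fin m → Bool) → Bool) (i : Fin m) : lab f i ∈ cls f i := Finset.min'_mem _ _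

/-- Exchangeable coordinates get the same label. -/
theorem lab_eq_of_sw {m : ℕ} (f : (Fin m → Bool) → Bool) {i k : Fin m} (h : Sw f i k) : lab f i = lab f k := by
  have e := cls_eq_of_sw f h
  apply le_antisymm
  · exact Finset.min'_le _ _ (by rw [e]; exact lab_mem f k)
  · exact Finset.min'_le _ _ (by rw [← e]; exact lab_mem f i)

/-- Block map of the BIG classes (size `≥ s`), labelled by their least element; the small classes form the free part. -/
noncomputable def blkCls {m : ℕ} (f : (Fin m → Bool) → Bool) (s : ℕ) (i : Fin m) : Option (Fin m) :=
  if s ≤ (cls f i).card then some (lab f i) else none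

/-- Coordinates in the same big-class block are exchangeable. -/
theorem blkCls_sw {m : ℕ} (f : (Fin m → Bool) → Bool) (s : ℕ) {i k : Fin m}
    (hik : blkCls f s i = blkCls f s k) (hi : blkCls f s i ≠ none) : Sw f i k := by
  unfold blkCls at hik hi
  by_cases hbi : s ≤ (cls f i).card
  · rw [if_pos hbi] at hik hi
    by_cases hbk : s ≤ (cls f k).card
    · rw [if_pos hbk] at hik
      have hl : lab f i = lab f k := Option.some.inj hik
      have h1 : Sw f i (lab f i) := (mem_cls f i _).1 (lab_mem f i)
      have h2 : Sw f k (lab f k) := (mem_cls f k _).1 (lab_mem f k)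
      rw [hl] at h1
      exact sw_trans f h1 (sw_symm f h2)
    · rw [if_neg hbk] at hik
      exact absurd hik (Option.some_ne_none _)
  · rw [if_neg hbi] at hi
    exact absurd rfl hi

/-- A big class is contained in its block. -/
theorem cls_subset_blkCls {m : ℕ} (f : (Fin m → Bool) → Bool) (s : ℕ) {i : Fin m} (hbi : s ≤ (cls f i).card) :
    cls f i ⊆ univ.filter fun k => blkCls f s k = blkCls f s i := by
  intro k hk
  rw [mem_cls] at hk
  have e : cls f k = cls f i := (cls_eq_of_sw f hk).symm
  have hbk : s ≤ (cls f k).card := by rw [e]; exact hbi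
  simp only [mem_filter, mem_univ, true_and, blkCls, if_pos hbi, if_pos hbk, lab_eq_of_sw f hk]

/-- Every block of `blkCls f s` has `≥ s` members. -/
theorem blkCls_big {m : ℕ} (f : (Fin m → Bool) → Bool) (s : ℕ) {i : Fin m} (hi : blkCls f s i ≠ none) :
    s ≤ (univ.filter fun k => blkCls f s k = blkCls f s i).card := by
  have hbi : s ≤ (cls f i).card := by
    by_contra h
    exact hi (by simp [blkCls, h])
  exact hbi.trans (card_le_card (cls_subset_blkCls f s hbi))

/-- A free coordinate of `blkCls f s` has a class of size `< s`. -/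
theorem card_cls_lt_of_blkCls_eq_none {m : ℕ} (f : (Fin m → Bool) → Bool) (s : ℕ) {i : Fin m}
    (hi : blkCls f s i = none) : (cls f i).card < s := by
  by_contra h
  rw [not_lt] at h
  simp [blkCls, h] at hi

/-- ★ KERNEL: Transfer ⟹ LocalToGlobal, with `N(p, j) = p^{K_T(p, j)}` (blocks = the classes of size `≥ 3p − 1`; column typing). -/
theorem localToGlobal_of_transfer (hT : TransferTwoOdd) : LocalToGlobalTwoOdd := by
  intro p _ hp j
  obtain ⟨K, hK⟩ := hT p hp j
  refine ⟨p ^ K, fun m f hf L hL hbig => ?_⟩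
  have h1 : (univ.filter fun i : Fin m => blkCls f (3 * p - 1) i = none).card ≤ j := by
    refine le_trans (card_le_card fun i hi => ?_) hL
    rw [mem_filter] at hi
    by_contra hiL
    have hlt := card_cls_lt_of_blkCls_eq_none f _ hi.2
    have hge := hbig i hiL
    rw [card_partners_eq] at hge
    omega
  obtain ⟨lam, F, hF⟩ := hK m m f (blkCls f (3 * p - 1)) hf h1
    (fun i k hik hi => blkCls_sw f _ hik hi) (fun i hi => blkCls_big f _ hi)
  exact fewTypes_of_forms f lam F hF

/-- The colour class (fibre) of a coordinate under a colouring `c`. -/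
noncomputable def colFib {m N : ℕ} (c : Fin m → Fin N) (i : Fin m) : Finset (Fin m) := univ.filter fun j => c j = c i

/-- Membership in a colour class. -/
theorem mem_colFib {m N : ℕ} (c : Fin m → Fin N) (i j : Fin m) : j ∈ colFib c i ↔ c j = c i := by
  simp [colFib]

/-- Equal colours give equal colour classes. -/
theorem colFib_eq {m N : ℕ} (c : Fin m → Fin N) {i k : Fin m} (h : c k = c i) : colFib c k = colFib c i := by
  ext j
  rw [mem_colFib, mem_colFib, h]

/-- At most `N·s` coordinates lie in colour classes of size `≤ s`. -/
theorem card_small_fibres_le {m N : ℕ} (c : Fin m → Fin N) (s : ℕ) :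
    (univ.filter fun i : Fin m => (colFib c i).card ≤ s).card ≤ N * s := by
  set L := (univ.filter fun i : Fin m => (colFib c i).card ≤ s) with hL
  have hmap : ∀ i ∈ L, c i ∈ (univ : Finset (Fin N)) := fun _ _ => mem_univ _
  rw [Finset.card_eq_sum_card_fiberwise hmap]
  calc ∑ b ∈ (univ : Finset (Fin N)), (L.filter fun i => c i = b).card
      ≤ ∑ b ∈ (univ : Finset (Fin N)), s := Finset.sum_le_sum fun b _ => ?_
    _ = N * s := by simp
  by_cases hne : (L.filter fun i => c i = b).Nonempty
  · obtain ⟨i, hi⟩ := hne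
    rw [mem_filter] at hi
    have hiL : i ∈ L := hi.1
    rw [hL, mem_filter] at hiL
    calc (L.filter fun i => c i = b).card ≤ (colFib c i).card := card_le_card fun j hj => by
            rw [mem_filter] at hj
            rw [mem_colFib, hj.2, hi.2]
      _ ≤ s := hiL.2
  · rw [not_nonempty_iff_eq_empty.1 hne, card_empty]
    exact Nat.zero_le _

/-- Block map of the BIG colour classes of a colouring (size `≥ s`); the small classes form the free part. -/
noncomputable def blkCol {m N : ℕ} (c : Fin m → Fin N) (s : ℕ) (i : Fin m) : Option (Fin N) :=
  if s ≤ (colFib c i).card then some (c i) else none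

/-- ★ KERNEL: Transfer ⟹ FormsFromFew, with `K(p, N) = K_T(p, N·(3p − 2))` (blocks = the colour classes of size `≥ 3p − 1`). -/
theorem formsFromFew_of_transfer (hT : TransferTwoOdd) : FormsFromFewTwoOdd := by
  intro p _ hp N
  obtain ⟨K, hK⟩ := hT p hp (N * (3 * p - 2))
  refine ⟨K, fun m f hf hc => ?_⟩
  obtain ⟨c, hc⟩ := hc
  have h1 : (univ.filter fun i : Fin m => blkCol c (3 * p - 1) i = none).card ≤ N * (3 * p - 2) := by
    refine le_trans (card_le_card fun i hi => ?_) (card_small_fibres_le c (3 * p - 2))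
    rw [mem_filter] at hi ⊢
    refine ⟨mem_univ _, ?_⟩
    by_contra h
    have hbi : 3 * p - 1 ≤ (colFib c i).card := by omega
    have hne : blkCol c (3 * p - 1) i ≠ none := by
      simp only [blkCol, if_pos hbi]
      exact Option.some_ne_none _
    exact hne hi.2
  have h2 : ∀ i k, blkCol c (3 * p - 1) i = blkCol c (3 * p - 1) k → blkCol c (3 * p - 1) i ≠ none → Sw f i k := by
    intro i k hik hi
    unfold blkCol at hik hi
    by_cases hbi : 3 * p - 1 ≤ (colFib c i).card
    · rw [if_pos hbi] at hik
      by_cases hbk : 3 * p - 1 ≤ (colFib c k).card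
      · rw [if_pos hbk] at hik
        exact hc i k (Option.some.inj hik)
      · rw [if_neg hbk] at hik
        exact absurd hik (Option.some_ne_none _)
    · rw [if_neg hbi] at hi
      exact absurd rfl hi
  have h3 : ∀ i, blkCol c (3 * p - 1) i ≠ none →
      3 * p - 1 ≤ (univ.filter fun k => blkCol c (3 * p - 1) k = blkCol c (3 * p - 1) i).card := by
    intro i hi
    have hbi : 3 * p - 1 ≤ (colFib c i).card := by
      by_contra h
      exact hi (by simp [blkCol, h])
    refine hbi.trans (card_le_card fun k hk => ?_)
    have hck : c k = c i := (mem_colFib c i k).1 hk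
    have hbk : 3 * p - 1 ≤ (colFib c k).card := by rw [colFib_eq c hck]; exact hbi
    simp only [mem_filter, mem_univ, true_and, blkCol, if_pos hbk, if_pos hbi, hck]
  exact hK m N f (blkCol c (3 * p - 1)) hf h1 h2 h3

end TransferKernel

/-- B ⟹ Transfer (trivially: the block hypotheses are ignored; kernel — keeps the carving exact). -/
theorem transfer_of_structureLaw (hB : StructureLawTwoOdd) : TransferTwoOdd := by
  intro p _ hp j
  obtain ⟨K, hK⟩ := hB p hp
  exact ⟨K, fun m r f b hf _ _ _ => hK m f hf⟩

/-- ★★ KERNEL: B ⟸ Transfer ∧ Partners. -/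
theorem closes_of_transfer (hT : TransferTwoOdd) (hP : PartnersTwoOdd) : StructureLawTwoOdd :=
  closes (formsFromFew_of_transfer hT) (localToGlobal_of_transfer hT) hP

/-- … the same with the junction displayed as a hypothesis: B ⟸ (PF ⟹ Transfer) ∧ PF ∧ Partners (see `closes_of_PF`, part E). -/
theorem closes_of_fieldCore (hPT : TransferOfFieldCore) (hPF : FieldCorePerPrime) (hP : PartnersTwoOdd) :
    StructureLawTwoOdd :=
  closes_of_transfer (hPT hPF) hP

/-- … and conversely (kernel): B ⟹ Transfer ∧ Partners. -/
theorem transfer_partners_of_structureLaw (hB : StructureLawTwoOdd) : TransferTwoOdd ∧ PartnersTwoOdd :=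
  ⟨transfer_of_structureLaw hB, partners_of_fewTypes (fewTypes_of_structureLaw hB)⟩

end Summit.QuantumAdvantage.QuantumAdvantage.Theorems.TransferDial
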